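import Summits.Ventures.QEC.Thresholds.BBFiniteSizeBounds
import Summits.Ventures.QEC.Theorems.BB144DistanceCertificateTarget
import Literature.InformationTheory.QuantumCodes.DepolarizingCSSDecoding
import HarnessLib

/-!
# Certified logical-error bounds under i.i.d. DEPOLARIZING noise for the bivariate-bicycle codes `[[72,12,6]]`
# and `[[144,12,12]]` (the gross code), sector-wise minimum-weight decoding — both UNCONDITIONAL, kernel

Venture QEC, `Summits/Ventures/QEC/Thresholds/` (LADDER-QEC rung Q5 × Q2, PARTITION row 09 "noise models: i.i.d.
depolarising"; qec-type-09 gen 3). qec-lit-2's `BBFiniteSizeBounds.lean` certifies, per error type, the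
Dumer–Kovalev–Pryadko finite-size bound `P_fail ≤ 2ℓm·(100 p(1-p))^{d/2} / (5(1-10√(p(1-p))))` for the cell's flagship
codes under INDEPENDENT flips. Under the DEPOLARIZING channel of rate `p` (each qubit suffers `X`, `Y`, `Z` with
probability `p/3` each) decoded sector-wise (`DX` on the bit-flip part, `DZ` on the phase-flip part), the two parts
are independent-flip patterns of rate `q = 2p/3` and failure is contained in the union of the two sector failures
(`CSSCode.depolarizingFailureProb_le`, `DepolarizingCSSDecoding.lean`), so, with `u := 100·q(1-q)`, `q = 2p/3`:

* `bb72_depolarizingFailureProb_le` — `[[72,12,6]]`: `P^depol_fail(p) ≤ 2·72·u³/(5(1-10√(q(1-q))))` for every pair of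
  minimum-weight decoders, `0 ≤ p ≤ 3/4`, `10√(q(1-q)) < 1`; `bb72_depolarizingFailureProb_le_poly`: `u ≤ 1/4 ⇒
  P ≤ 57.6·u³` (e.g. `p = 10⁻³`: `u ≈ .0666`, `P ≤ 1.7·10⁻²`; `p = 10⁻⁴`: `P ≤ 1.7·10⁻⁵`). Distance input: the KERNEL
  theorem `bb72_d` (route BB72DistanceCertificate).
* `bb144_depolarizingFailureProb_le` — `[[144,12,12]]`: `P^depol_fail(p) ≤ 2·144·u⁶/(5(1-10√(q(1-q))))`;
  `bb144_depolarizingFailureProb_le_poly`: `u ≤ 1/4 ⇒ P ≤ 115.2·u⁶` (e.g. `p = 10⁻³`: `P ≤ 1.0·10⁻⁵`). Distance input: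
  `BB144_12_12_claim_holds` (route BB144DistanceCertificate, KERNEL-std since p487807) — so these rows are
  UNCONDITIONAL, unlike the `h : BB144_12_12_claim`-hypothesis rows of `BBFiniteSizeBounds.lean` which this file
  discharges on the way (`bb144_zFailureProb_le_holds`, `bb144_xFailureProb_le_holds`).

HONEST FRAMING: rigorous UPPER bounds (union bounds, not tight), kernel axioms, no named fact, no `native_decide`;
the decoder class is sector-wise minimum-weight decoding (correlations of `Y` errors ignored); Monte Carlo logical
error rates of BP-OSD under circuit noise (Bravyi et al. 2024) are VALIDATED-column numbers, not comparable.

## References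

* [DumerKovalevPryadko2015] I. Dumer, A. A. Kovalev, L. P. Pryadko, PRL 115 (2015) 050502, Thm 2, eq.
  (succesful-decoding-depolarizing).
* [BravyiEtAl2024] S. Bravyi et al., Nature 627 (2024) 778, Table 1 (`[[72,12,6]]`, `[[144,12,12]]`).
* [DennisEtAl2002] E. Dennis, A. Kitaev, A. Landahl, J. Preskill, J. Math. Phys. 43 (2002) 4452, §4.1.
-/

noncomputable section

namespace Summit.Ventures.QEC.Thresholds

open Finset Matrix
open Literature.InformationTheory.QuantumCodes
open Summit.Ventures.QEC.BB Summit.Ventures.QEC.Census.BB144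

/-- `0 ≤ p ≤ 3/4` puts the marginal rate `q = 2p/3` in `[0, 1/2]`. [folklore] -/
private theorem two_mul_div_three_range {p : ℝ} (hp0 : 0 ≤ p) (hp : p ≤ 3 / 4) :
    0 ≤ 2 * p / 3 ∧ 2 * p / 3 ≤ 1 / 2 := ⟨by positivity, by linarith⟩

/-! ### `[[72, 12, 6]]` -/

open Classical in
/-- **`[[72,12,6]]` under depolarizing noise**: for EVERY pair of minimum-weight decoders (`DX` of the `Z`-syndrome,
`DZ` of the `X`-syndrome), every `0 ≤ p ≤ 3/4` with `10√(q(1-q)) < 1`, `q = 2p/3`: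
`P^depol_fail(p) ≤ 2·(72·(100 q(1-q))³ / (5(1-10√(q(1-q)))))`. UNCONDITIONAL, kernel.
[cite: DumerKovalevPryadko2015, Thm 2 (w = 6) with eq. (succesful-decoding-depolarizing)] -/
theorem bb72_depolarizingFailureProb_le
    {DX : Decoder (BB.Mono 6 6 → ZMod 2) (BB.Mono 6 6 ⊕ BB.Mono 6 6 → ZMod 2)}
    {DZ : Decoder (BB.Mono 6 6 → ZMod 2) (BB.Mono 6 6 ⊕ BB.Mono 6 6 → ZMod 2)}
    (hDX : DX.IsMinWeight BB.bb72.css.xSyndrome (BB.bb72.css.kerZ : Set (BB.Mono 6 6 ⊕ BB.Mono 6 6 → ZMod 2))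
      hammingNorm)
    (hDZ : DZ.IsMinWeight BB.bb72.css.zSyndrome (BB.bb72.css.kerX : Set (BB.Mono 6 6 ⊕ BB.Mono 6 6 → ZMod 2))
      hammingNorm)
    {p : ℝ} (hp0 : 0 ≤ p) (hp : p ≤ 3 / 4)
    (hr : 10 * Real.sqrt (2 * p / 3 * (1 - 2 * p / 3)) < 1) :
    BB.bb72.css.depolarizingFailureProb DX DZ p ≤
      2 * (72 * (100 * (2 * p / 3 * (1 - 2 * p / 3))) ^ 3 / (5 * (1 - 10 * Real.sqrt (2 * p / 3 * (1 - 2 * p / 3))))) := by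
  obtain ⟨hq0, hq⟩ := two_mul_div_three_range hp0 hp
  have h := BB.bb72.css.depolarizingFailureProb_le DX DZ hp0 (by linarith)
  have hX := bb72_xFailureProb_le hDX hq0 hq hr
  have hZ := bb72_zFailureProb_le hDZ hq0 hq hr
  linarith

open Classical in
/-- **`[[72,12,6]]`, depolarizing, polynomial form**: if `100 q(1-q) ≤ 1/4` (`q = 2p/3`; e.g. every `p ≤ .0037`)
then `P^depol_fail(p) ≤ 57.6·(100 q(1-q))³`. UNCONDITIONAL, kernel. [cite: DumerKovalevPryadko2015, Thm 2 (w = 6)] -/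
theorem bb72_depolarizingFailureProb_le_poly
    {DX : Decoder (BB.Mono 6 6 → ZMod 2) (BB.Mono 6 6 ⊕ BB.Mono 6 6 → ZMod 2)}
    {DZ : Decoder (BB.Mono 6 6 → ZMod 2) (BB.Mono 6 6 ⊕ BB.Mono 6 6 → ZMod 2)}
    (hDX : DX.IsMinWeight BB.bb72.css.xSyndrome (BB.bb72.css.kerZ : Set (BB.Mono 6 6 ⊕ BB.Mono 6 6 → ZMod 2))
      hammingNorm)
    (hDZ : DZ.IsMinWeight BB.bb72.css.zSyndrome (BB.bb72.css.kerX : Set (BB.Mono 6 6 ⊕ BB.Mono 6 6 → ZMod 2))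
      hammingNorm)
    {p : ℝ} (hp0 : 0 ≤ p) (hp : p ≤ 3 / 4) (hsmall : 100 * (2 * p / 3 * (1 - 2 * p / 3)) ≤ 1 / 4) :
    BB.bb72.css.depolarizingFailureProb DX DZ p ≤ 57.6 * (100 * (2 * p / 3 * (1 - 2 * p / 3))) ^ 3 := by
  obtain ⟨hq0, hq⟩ := two_mul_div_three_range hp0 hp
  have h := BB.bb72.css.depolarizingFailureProb_le DX DZ hp0 (by linarith)
  have hX := bb72_xFailureProb_le_poly hDX hq0 hq hsmall
  have hZ := bb72_zFailureProb_le_poly hDZ hq0 hq hsmall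
  linarith

/-- Non-vacuity of the decoder class: the canonical pair of minimum-weight decoders of `[[72,12,6]]` qualifies.
[cite: DumerKovalevPryadko2015, p. 3 (exhaustive minimum-weight decoding)] -/
theorem bb72_depolarizingFailureProb_le_poly_minWeight {p : ℝ} (hp0 : 0 ≤ p) (hp : p ≤ 3 / 4)
    (hsmall : 100 * (2 * p / 3 * (1 - 2 * p / 3)) ≤ 1 / 4) :
    BB.bb72.css.depolarizingFailureProb (Decoder.minWeight BB.bb72.css.xSyndrome hammingNorm)
        (Decoder.minWeight BB.bb72.css.zSyndrome hammingNorm) p ≤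
      57.6 * (100 * (2 * p / 3 * (1 - 2 * p / 3))) ^ 3 :=
  bb72_depolarizingFailureProb_le_poly BB.bb72.css.isMinWeight_minWeight_xSyndrome
    BB.bb72.css.isMinWeight_minWeight_zSyndrome hp0 hp hsmall

/-! ### `[[144, 12, 12]]` — unconditional via `BB144_12_12_claim_holds` (KERNEL-std) -/

open Classical in
/-- **`[[144,12,12]]`, `Z`-errors, code capacity, UNCONDITIONAL**: qec-lit-2's `bb144_zFailureProb_le` with its
hypothesis discharged by the kernel theorem `BB144_12_12_claim_holds`: `P_fail ≤ 144·(100 p(1-p))⁶/(5(1-10√(p(1-p))))`.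
[cite: DumerKovalevPryadko2015, Thm 2 (y = 0, w = 6)] -/
theorem bb144_zFailureProb_le_holds
    {D : Decoder (BB.Mono 12 6 → ZMod 2) (BB.Mono 12 6 ⊕ BB.Mono 12 6 → ZMod 2)}
    (hD : D.IsMinWeight BB.bb144.css.zSyndrome
      (BB.bb144.css.kerX : Set (BB.Mono 12 6 ⊕ BB.Mono 12 6 → ZMod 2)) hammingNorm)
    {p : ℝ} (hp0 : 0 ≤ p) (hp : p ≤ 1 / 2) (hr : 10 * Real.sqrt (p * (1 - p)) < 1) :
    ∑ e ∈ univ.filter (fun e : BB.Mono 12 6 ⊕ BB.Mono 12 6 → ZMod 2 =>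
        ¬ D.Corrects BB.bb144.css.zSyndrome
          (BB.bb144.css.rowSpZ : Set (BB.Mono 12 6 ⊕ BB.Mono 12 6 → ZMod 2)) e),
        bernoulliWeight p (supp e) ≤
      144 * (100 * (p * (1 - p))) ^ 6 / (5 * (1 - 10 * Real.sqrt (p * (1 - p)))) :=
  bb144_zFailureProb_le BB144_12_12_claim_holds hD hp0 hp hr

open Classical in
/-- **`[[144,12,12]]`, `X`-errors, code capacity, UNCONDITIONAL** (hypothesis of `bb144_xFailureProb_le` discharged).
[cite: DumerKovalevPryadko2015, Thm 2 (y = 0, w = 6)] -/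
theorem bb144_xFailureProb_le_holds
    {D : Decoder (BB.Mono 12 6 → ZMod 2) (BB.Mono 12 6 ⊕ BB.Mono 12 6 → ZMod 2)}
    (hD : D.IsMinWeight BB.bb144.css.xSyndrome
      (BB.bb144.css.kerZ : Set (BB.Mono 12 6 ⊕ BB.Mono 12 6 → ZMod 2)) hammingNorm)
    {p : ℝ} (hp0 : 0 ≤ p) (hp : p ≤ 1 / 2) (hr : 10 * Real.sqrt (p * (1 - p)) < 1) :
    ∑ e ∈ univ.filter (fun e : BB.Mono 12 6 ⊕ BB.Mono 12 6 → ZMod 2 =>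
        ¬ D.Corrects BB.bb144.css.xSyndrome
          (BB.bb144.css.rowSpX : Set (BB.Mono 12 6 ⊕ BB.Mono 12 6 → ZMod 2)) e),
        bernoulliWeight p (supp e) ≤
      144 * (100 * (p * (1 - p))) ^ 6 / (5 * (1 - 10 * Real.sqrt (p * (1 - p)))) :=
  bb144_xFailureProb_le BB144_12_12_claim_holds hD hp0 hp hr

open Classical in
/-- **The gross code `[[144,12,12]]` under depolarizing noise**: for EVERY pair of minimum-weight decoders and every
`0 ≤ p ≤ 3/4` with `10√(q(1-q)) < 1`, `q = 2p/3`: `P^depol_fail(p) ≤ 2·(144·(100 q(1-q))⁶ / (5(1-10√(q(1-q)))))`.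
UNCONDITIONAL, kernel (distance by `BB144_12_12_claim_holds`).
[cite: DumerKovalevPryadko2015, Thm 2 (w = 6) with eq. (succesful-decoding-depolarizing)] [cite: BravyiEtAl2024, Table 1 ([[144,12,12]])] -/
theorem bb144_depolarizingFailureProb_le
    {DX : Decoder (BB.Mono 12 6 → ZMod 2) (BB.Mono 12 6 ⊕ BB.Mono 12 6 → ZMod 2)}
    {DZ : Decoder (BB.Mono 12 6 → ZMod 2) (BB.Mono 12 6 ⊕ BB.Mono 12 6 → ZMod 2)}
    (hDX : DX.IsMinWeight BB.bb144.css.xSyndrome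
      (BB.bb144.css.kerZ : Set (BB.Mono 12 6 ⊕ BB.Mono 12 6 → ZMod 2)) hammingNorm)
    (hDZ : DZ.IsMinWeight BB.bb144.css.zSyndrome
      (BB.bb144.css.kerX : Set (BB.Mono 12 6 ⊕ BB.Mono 12 6 → ZMod 2)) hammingNorm)
    {p : ℝ} (hp0 : 0 ≤ p) (hp : p ≤ 3 / 4)
    (hr : 10 * Real.sqrt (2 * p / 3 * (1 - 2 * p / 3)) < 1) :
    BB.bb144.css.depolarizingFailureProb DX DZ p ≤
      2 * (144 * (100 * (2 * p / 3 * (1 - 2 * p / 3))) ^ 6 /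
        (5 * (1 - 10 * Real.sqrt (2 * p / 3 * (1 - 2 * p / 3))))) := by
  obtain ⟨hq0, hq⟩ := two_mul_div_three_range hp0 hp
  have h := BB.bb144.css.depolarizingFailureProb_le DX DZ hp0 (by linarith)
  have hX := bb144_xFailureProb_le_holds hDX hq0 hq hr
  have hZ := bb144_zFailureProb_le_holds hDZ hq0 hq hr
  linarith

open Classical in
/-- **`[[144,12,12]]`, depolarizing, polynomial form**: `100 q(1-q) ≤ 1/4` (`q = 2p/3`) ⇒
`P^depol_fail(p) ≤ 115.2·(100 q(1-q))⁶` (e.g. `p = 10⁻³`: `≤ 1.0·10⁻⁵`). UNCONDITIONAL, kernel.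
[cite: DumerKovalevPryadko2015, Thm 2 (w = 6)] [cite: BravyiEtAl2024, Table 1 ([[144,12,12]])] -/
theorem bb144_depolarizingFailureProb_le_poly
    {DX : Decoder (BB.Mono 12 6 → ZMod 2) (BB.Mono 12 6 ⊕ BB.Mono 12 6 → ZMod 2)}
    {DZ : Decoder (BB.Mono 12 6 → ZMod 2) (BB.Mono 12 6 ⊕ BB.Mono 12 6 → ZMod 2)}
    (hDX : DX.IsMinWeight BB.bb144.css.xSyndrome
      (BB.bb144.css.kerZ : Set (BB.Mono 12 6 ⊕ BB.Mono 12 6 → ZMod 2)) hammingNorm)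
    (hDZ : DZ.IsMinWeight BB.bb144.css.zSyndrome
      (BB.bb144.css.kerX : Set (BB.Mono 12 6 ⊕ BB.Mono 12 6 → ZMod 2)) hammingNorm)
    {p : ℝ} (hp0 : 0 ≤ p) (hp : p ≤ 3 / 4) (hsmall : 100 * (2 * p / 3 * (1 - 2 * p / 3)) ≤ 1 / 4) :
    BB.bb144.css.depolarizingFailureProb DX DZ p ≤ 115.2 * (100 * (2 * p / 3 * (1 - 2 * p / 3))) ^ 6 := by
  obtain ⟨hq0, hq⟩ := two_mul_div_three_range hp0 hp
  have h := BB.bb144.css.depolarizingFailureProb_le DX DZ hp0 (by linarith)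
  have hX := bb144_xFailureProb_le_poly BB144_12_12_claim_holds hDX hq0 hq hsmall
  have hZ := bb144_zFailureProb_le_poly BB144_12_12_claim_holds hDZ hq0 hq hsmall
  linarith

/-- Non-vacuity: the canonical minimum-weight decoder pair of the gross code qualifies.
[cite: DumerKovalevPryadko2015, p. 3 (exhaustive minimum-weight decoding)] -/
theorem bb144_depolarizingFailureProb_le_poly_minWeight {p : ℝ} (hp0 : 0 ≤ p) (hp : p ≤ 3 / 4)
    (hsmall : 100 * (2 * p / 3 * (1 - 2 * p / 3)) ≤ 1 / 4) :
    BB.bb144.css.depolarizingFailureProb (Decoder.minWeight BB.bb144.css.xSyndrome hammingNorm)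
        (Decoder.minWeight BB.bb144.css.zSyndrome hammingNorm) p ≤
      115.2 * (100 * (2 * p / 3 * (1 - 2 * p / 3))) ^ 6 :=
  bb144_depolarizingFailureProb_le_poly BB.bb144.css.isMinWeight_minWeight_xSyndrome
    BB.bb144.css.isMinWeight_minWeight_zSyndrome hp0 hp hsmall

end Summit.Ventures.QEC.Thresholds
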